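import Mathlib
import Summits.MatrixMultiplication.Statement
import Summits.MatrixMultiplication.MatrixMultiplication.Theorems.GraphEquationsHorizontalDerivation

/-!
# The flat engine: `d` purifying directions give `R(⟨n,n,n⟩) ≤ 2·9^d·cost` (`GraphEquations`, M60b)

Decomp-mm node «GraphEquations» (lens 5, g42); attacked leaf `MultiplicityReduction`
(stmt-MatrixMultiplication-27806).  Target VERBATIM: `_root_.MatrixMultiplication`.  Route-neutral.

M60a (`GraphEquationsHorizontalDerivation`) fed ONE direction to the tangent-word engine.  Here the
FLAT version, which makes the cell's dial `φ` official: if a correct system `E` with affine tests `g`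
has a base `(A,B)` and directions `v_1 … v_d` such that NO nonzero kernel vector persists along the flat
`(A,B) + span(v_a)` (`AffSystem.PersistsAlongFlat`, M58), then the words in `X_{v_1}, …, X_{v_d}` —
each field used twice, `Ξ = [X_{v_a}]_a ++ [X_{v_a}]_a` — have linear `c`-rows spanning `ℂ^{n²}`
(the sublists `[]`, `[X_a]`, `[X_a, X_b]` give the rows `J`, `∂_a J`, `M(U_aV_b + U_bV_a)`, and
`persistsAlongFlat_iff_pairwise`), so the engine M20c gives
`tensorRank_le_of_flat : R(⟨n,n,n⟩) ≤ 2·3^{2d}·cost E`.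
The dial `HorizontalUnmask d n` («every correct cubic system for `W_n` has purification depth
`φ ≤ d`») therefore satisfies `(∀ n ≥ 3, HorizontalUnmask d n) → CubicEquationsForceMultiplication`
for every FIXED `d` (`cubicEquationsForceMultiplication_of_horizontalUnmask`).  Designs have `φ = 1`
(M57); `φ ≤ 2n²` always (M58 `eq_zero_of_persistsAlongFlat_all`); whether `φ = O(1)` on all correct
cubic systems is the cell's open question (Q*).
Sources: [BurgisserClausenShokrollahi1997, §4.1 Rem. (4.3), (7.7), Prop. (14.1), Problem 16.3];
[LeykinVerscheldeZhao2006, Thm. 3.1].  No `sorry`.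
-/

-- dupNamespace: forced by the nested Summit.MatrixMultiplication.MatrixMultiplication layout (D-0017)
set_option linter.dupNamespace false

noncomputable section

namespace Summit.MatrixMultiplication.MatrixMultiplication.Theorems.GraphEquations

open Matrix MvPolynomial
open Literature.Computability.AlgebraicComplexity

variable {n : ℕ}

/-- From «all word rows of `[]`, `[X_a]`, `[X_a, X_b]` kill `δ`» to persistence along the flat. -/
theorem AffSystem.persistsAlongFlat_of_rows (S : AffSystem n) {d : ℕ} {A B : Vec n}
    {U V : Fin d → Vec n} {δ : Vec n} (h0 : S.IsKer A B δ)
    (h1 : ∀ a i, ((S.test i).hderiv (U a) (V a)).jac A B ⬝ᵥ δ = 0)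
    (h2 : ∀ a b i, ((S.test i).M *ᵥ (prodVec (U a) (V b) + prodVec (U b) (V a))) ⬝ᵥ δ = 0) :
    S.PersistsAlongFlat A B U V δ := by
  have hsq : ∀ a i, ((S.test i).M *ᵥ prodVec (U a) (V a)) ⬝ᵥ δ = 0 := fun a i => by
    have := h2 a a i
    rw [mulVec_add, add_dotProduct] at this
    linear_combination this / 2
  refine AffSystem.persistsAlongFlat_iff_pairwise.2 ⟨h0, fun a => ?_, fun a b => ?_⟩
  · exact AffSystem.persistsAlong_iff.2 ⟨h0, h1 a, hsq a⟩
  · refine AffSystem.persistsAlong_iff.2 ⟨h0, fun i => ?_, fun i => ?_⟩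
    · rw [AffTest.jac_hderiv_add, add_dotProduct, h1 a i, h1 b i, add_zero]
    · rw [prodVec_add_add, mulVec_add, mulVec_add, mulVec_add, add_dotProduct, add_dotProduct,
        add_dotProduct, hsq a i, hsq b i, add_zero, zero_add]
      have := h2 a b i
      rwa [add_comm, mulVec_add, add_dotProduct] at this

set_option maxHeartbeats 400000 in
/-- **THE FLAT ENGINE.**  A correct system `E` with affine tests `g`, a base `(A,B)` and `d` directions
`(U_a, V_a)` along whose flat no nonzero kernel vector persists gives `R(⟨n,n,n⟩) ≤ 2·3^{2d}·cost E`. -/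
theorem tensorRank_le_of_flat {E : EqSystem n} (hE : E.Correct) {g : Fin E.tests.length → AffTest n}
    (hg : ∀ o A B C, MvPolynomial.eval (pt A B C) (E.testPoly (E.tests.get o)) = (g o).eval A B C)
    {d : ℕ} {A B : Vec n} {U V : Fin d → Vec n}
    (hred : ∀ δ, (affSystemOf g).PersistsAlongFlat A B U V δ → δ = 0) :
    tensorRank (matMulTensor ℂ n n n) ≤ 2 * (3 ^ (2 * d) * E.cost) := by
  classical
  have hpoly : ∀ o, E.testPoly (E.tests.get o) = (g o).poly := fun o => eq_poly_of_eval_eq (hg o)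
  let Ds : List (Derivation ℂ (MvPolynomial (GraphVars n) ℂ) (MvPolynomial (GraphVars n) ℂ)) :=
    List.ofFn fun a => hDer (U a) (V a)
  have hmemDs : ∀ a, hDer (U a) (V a) ∈ Ds := fun a => List.mem_ofFn.2 ⟨a, rfl⟩
  have hmem : ∀ D ∈ Ds ++ Ds, ∃ a, D = hDer (U a) (V a) := by
    intro D hD
    rcases List.mem_append.1 hD with hD | hD <;>
    · obtain ⟨a, ha⟩ := List.mem_ofFn.1 hD
      exact ⟨a, ha.symm⟩
  have hlen : (Ds ++ Ds).length = 2 * d := by simp [Ds, two_mul]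
  rw [← hlen]
  refine EqSystem.tensorRank_le_of_tangentWordsAt hE.1 (fun j hj => hE.testPoly_mem_graphIdeal' hj)
    (Sum.elim A B) (Ds ++ Ds) ?_ ?_ ?_
  · intro D hD v
    obtain ⟨a, rfl⟩ := hmem D hD
    exact hDer_affine _ _ v
  · intro D hD q
    obtain ⟨a, rfl⟩ := hmem D hD
    exact hDer_generator _ _ q
  · let r : Fin E.tests.length × Fin (Ds ++ Ds).sublists.length → Vec n := fun os q' =>
      coeff (Finsupp.single (Sum.inr q' : GraphVars n) 1)
        (((Ds ++ Ds).sublists.get os.2).foldl (fun acc D => D acc)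
          (translate (Sum.elim A B) (E.testPoly (E.tests.get os.1))))
    have row : ∀ (L : List (Vec n × Vec n)) (s : Fin (Ds ++ Ds).sublists.length),
        (Ds ++ Ds).sublists.get s = L.map (fun uv => hDer uv.1 uv.2) → ∀ o,
          r (o, s) = (L.foldl (fun h uv => h.hderiv uv.1 uv.2) (g o)).jac A B := by
      intro L s hs o
      funext q'
      simp only [r, hs, hpoly, linRow_foldl_hDer]
    -- indices of the sublists [], [X_a], [X_a, X_b]
    have idx : ∀ L : List (Vec n × Vec n), List.Sublist (L.map fun uv => hDer uv.1 uv.2) (Ds ++ Ds) →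
        ∃ s, (Ds ++ Ds).sublists.get s = L.map (fun uv => hDer uv.1 uv.2) := fun L hL =>
      List.mem_iff_get.1 (List.mem_sublists.2 hL)
    have hr : ∀ δ : Vec n, (∀ os, r os ⬝ᵥ δ = 0) → δ = 0 := by
      intro δ hδ
      refine hred δ (AffSystem.persistsAlongFlat_of_rows _ ?_ ?_ ?_)
      · obtain ⟨s, hs⟩ := idx [] (List.nil_sublist _)
        intro o
        have h := hδ (o, s)
        rwa [row [] s hs o] at h
      · intro a o
        obtain ⟨s, hs⟩ := idx [(U a, V a)] (List.singleton_sublist.2 (List.mem_append_left _ (hmemDs a)))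
        have h := hδ (o, s)
        rwa [row _ s hs o] at h
      · intro a b o
        obtain ⟨s, hs⟩ := idx [(U a, V a), (U b, V b)]
          ((List.singleton_sublist.2 (hmemDs a)).append (List.singleton_sublist.2 (hmemDs b)))
        have h := hδ (o, s)
        rw [row _ s hs o] at h
        simp only [List.foldl_cons, List.foldl_nil, AffTest.jac_hderiv_hderiv] at h
        exact h
    intro q
    obtain ⟨P, hP⟩ := exists_combination_of_forall_dotProduct r hr (fun q' => if q = q' then 1 else 0)
    refine ⟨fun o s => P (o, s), fun q' => ?_⟩
    rw [← hP q', Fintype.sum_prod_type]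

/-! ## The dial `φ ≤ d` and the exponent -/

/-- **`HorizontalUnmask d n` (purification depth `φ ≤ d`).**  Every correct CUBIC system for `W_n`, in
any affine normal form, has a base and `d` directions along whose flat no nonzero kernel vector
persists.  `d = 0` is «reduced somewhere» (false in general: nowhere-reduced designs, M51/M54);
`d = 1` holds for the designs (M57); `d = 2n²` holds for every correct system (M58); monotone in `d`. -/
def HorizontalUnmask (d n : ℕ) : Prop :=
  ∀ E : EqSystem n, E.Correct → E.IsCubic →
    ∀ g : Fin E.tests.length → AffTest n,
      (∀ o A B C, MvPolynomial.eval (pt A B C) (E.testPoly (E.tests.get o)) = (g o).eval A B C) →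
        ∃ (A B : Vec n) (U V : Fin d → Vec n), ∀ δ, (affSystemOf g).PersistsAlongFlat A B U V δ → δ = 0

/-- Depth one in the sense of M60a gives `HorizontalUnmask 1`. -/
theorem horizontalUnmask_one_of_horizontalUnmaskOne (h : HorizontalUnmaskOne n) : HorizontalUnmask 1 n := by
  intro E hE hc g hg
  obtain ⟨A, B, U, V, hred⟩ := h E hE hc g hg
  refine ⟨A, B, fun _ => U, fun _ => V, fun δ hδ => AffSystem.reducedAt_happend₂_iff.1 hred δ ?_⟩
  have := hδ.line (fun _ => 1)
  simpa using this

/-- **The top of the dial is a theorem**: `HorizontalUnmask (n² + n²) n` — the `2n²` coordinate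
directions span all directions, and no nonzero kernel vector of a CORRECT system persists along every
line (M58 `Correct.eq_zero_of_persistsAlongFlat_all`).  So the content of the dial is the DEPTH `d`
being bounded independently of `n`. -/
theorem horizontalUnmask_top (n : ℕ) : HorizontalUnmask (n * n + n * n) n := by
  classical
  intro E hE hc g hg
  have hcard : Fintype.card ((Fin n × Fin n) ⊕ (Fin n × Fin n)) = n * n + n * n := by
    simp [Fintype.card_sum, Fintype.card_prod]
  let e : Fin (n * n + n * n) ≃ (Fin n × Fin n) ⊕ (Fin n × Fin n) :=
    (Fintype.equivFinOfCardEq hcard).symm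
  let U : Fin (n * n + n * n) → Vec n := fun a => Sum.elim (fun p => Pi.single p (1 : ℂ)) (fun _ => 0) (e a)
  let V : Fin (n * n + n * n) → Vec n := fun a => Sum.elim (fun _ => 0) (fun p => Pi.single p (1 : ℂ)) (e a)
  refine ⟨0, 0, U, V, fun δ hδ => (affSystemOf_correct hE hg).eq_zero_of_persistsAlongFlat_all ?_ hδ⟩
  intro U' V'
  refine ⟨fun a => Sum.elim U' V' (e a), ?_, ?_⟩
  · have h1 : (∑ a, Sum.elim U' V' (e a) • U a) =
        ∑ x : (Fin n × Fin n) ⊕ (Fin n × Fin n),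
          Sum.elim U' V' x • Sum.elim (fun p => Pi.single p (1 : ℂ)) (fun _ => (0 : Vec n)) x :=
      e.sum_comp (fun x => Sum.elim U' V' x • Sum.elim (fun p => Pi.single p (1 : ℂ)) (fun _ => 0) x)
    rw [h1, Fintype.sum_sum_type]
    funext q
    simp [Finset.sum_apply, Pi.single_apply]
  · have h1 : (∑ a, Sum.elim U' V' (e a) • V a) =
        ∑ x : (Fin n × Fin n) ⊕ (Fin n × Fin n),
          Sum.elim U' V' x • Sum.elim (fun _ => (0 : Vec n)) (fun p => Pi.single p (1 : ℂ)) x :=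
      e.sum_comp (fun x => Sum.elim U' V' x • Sum.elim (fun _ => 0) (fun p => Pi.single p (1 : ℂ)) x)
    rw [h1, Fintype.sum_sum_type]
    funext q
    simp [Finset.sum_apply, Pi.single_apply]

/-- **`(∀ n ≥ 3, HorizontalUnmask d n) → CubicEquationsForceMultiplication`** for every FIXED depth
`d`: bounded purification depth on the cubic range forces `ω ≤ β` (constant `2·9^d`). -/
theorem cubicEquationsForceMultiplication_of_horizontalUnmask (d : ℕ)
    (h : ∀ n : ℕ, 3 ≤ n → HorizontalUnmask d n) : CubicEquationsForceMultiplication := by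
  intro β _ hcub
  obtain ⟨c, hc⟩ := hcub
  have hmem : β ∈ admissibleExponents ℂ := by
    change (fun n : ℕ => (tensorRank (matMulTensor ℂ n n n) : ℝ)) =O[Filter.atTop]
      fun n : ℕ => (n : ℝ) ^ β
    refine Asymptotics.IsBigO.of_bound (2 * 3 ^ (2 * d) * |c|) ?_
    filter_upwards [Filter.eventually_ge_atTop 3] with n hn
    obtain ⟨E, hE, hcubic, hcost⟩ := hc n (by omega)
    obtain ⟨g, hg⟩ := exists_affTests hn hE hcubic
    obtain ⟨A, B, U, V, hred⟩ := h n hn E hE hcubic g hg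
    have h1 : (tensorRank (matMulTensor ℂ n n n) : ℝ) ≤ 2 * 3 ^ (2 * d) * (E.cost : ℝ) := by
      have := tensorRank_le_of_flat hE hg hred
      rw [← mul_assoc] at this
      exact_mod_cast this
    rw [Real.norm_of_nonneg (Nat.cast_nonneg _),
      Real.norm_of_nonneg (Real.rpow_nonneg (Nat.cast_nonneg _) _)]
    have h4 : c * (n : ℝ) ^ β ≤ |c| * (n : ℝ) ^ β := by
      gcongr
      exact le_abs_self c
    have h9 : (0 : ℝ) ≤ 2 * 3 ^ (2 * d) := by positivity
    calc (tensorRank (matMulTensor ℂ n n n) : ℝ) ≤ 2 * 3 ^ (2 * d) * (E.cost : ℝ) := h1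
      _ ≤ 2 * 3 ^ (2 * d) * (|c| * (n : ℝ) ^ β) := mul_le_mul_of_nonneg_left (hcost.trans h4) h9
      _ = 2 * 3 ^ (2 * d) * |c| * (n : ℝ) ^ β := by ring
  exact csInf_le (admissibleExponents_bddBelow ℂ) hmem

end Summit.MatrixMultiplication.MatrixMultiplication.Theorems.GraphEquations

end
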